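import Literature.NumberTheory.LFunctions.ChebyshevSylvesterPsi
import Literature.NumberTheory.LFunctions.PrimeSquareTail
import Mathlib.NumberTheory.AbelSummation
import HarnessLib

/-!
# Sums of `1/p` over prime windows from the Chebyshev–Sylvester `θ`-sandwich

Topic `Literature/NumberTheory/LFunctions`. Pure proof file.

For the explicit theory of smooth numbers in Ford's bounds (Ford 2002, Lemmas 2.2–2.3) one needs
two-sided bounds for `∑_{y < p ≤ x} 1/p` with an error far smaller than the `8/log x` of the
tree's Mertens theorem; Ford uses Rosser–Schoenfeld's `1/(2 log² x)`. Here Abel summation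
(`sum_mul_eq_sub_sub_integral_mul`) with the PROVED sandwich
`0.9392 t − 9√t − 2√t log t ≤ θ(t) ≤ 1.0722 t + 7√t` (`theta_bounds_sylvester`) gives, for
`e¹⁰ ≤ y ≤ x`:

(the partial-sum identity is `PrimeSquareTail.sum_Icc_ite_prime_log`)

* `sum_inv_primes_window_eq` — `∑_{y<p≤x} 1/p = θ(x)/(x log x) − θ(y)/(y log y) + ∫_y^x θ(t)(log t+1)/(t² log² t) dt`;
* `sum_inv_primes_window_ge` — `∑_{y<p≤x} 1/p ≥ 0.9392 · log(log x/log y) − 0.133/log y − 12/√y`;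
* `sum_inv_primes_window_le` — `∑_{y<p≤x} 1/p ≤ 1.0722 · log(log x/log y) + 0.133/log y + 12/√y`.

## References

* K. Ford, Proc. London Math. Soc. (3) 85 (2002), 565–633, §2 (the rôle of (2.3)). [Ford2002]
* G. H. Hardy, E. M. Wright, *An Introduction to the Theory of Numbers*, Thm 421 (Abel summation).
  [HardyWright2008]
-/

noncomputable section

open Real Finset MeasureTheory Set intervalIntegral
open scoped Chebyshev

namespace Literature.NumberTheory.LFunctions
namespace MertensChebyshev

/-- **Abel summation for `∑ 1/p` against `θ`.** For `2 ≤ y ≤ x`: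
`∑_{y<p≤x} 1/p = θ(x)/(x log x) − θ(y)/(y log y) + ∫_y^x θ(t)(log t + 1)/(t log t)² dt`. [folklore] -/
theorem sum_inv_primes_window_eq {y x : ℝ} (hy : 2 ≤ y) (hyx : y ≤ x) :
    ∑ p ∈ (Finset.Ioc ⌊y⌋₊ ⌊x⌋₊).filter Nat.Prime, (1 : ℝ) / p
      = θ x / (x * Real.log x) - θ y / (y * Real.log y)
        + ∫ t in Set.Ioc y x, θ t * ((Real.log t + 1) / (t * Real.log t) ^ 2) := by
  set c : ℕ → ℝ := fun k ↦ if k.Prime then Real.log k else 0 with hc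
  set f : ℝ → ℝ := fun t ↦ (t * Real.log t)⁻¹ with hf
  set g : ℝ → ℝ := fun t ↦ -((Real.log t + 1) / (t * Real.log t) ^ 2) with hg
  have hderiv : ∀ t : ℝ, 1 < t → HasDerivAt f (g t) t := by
    intro t ht
    have ht0 : t ≠ 0 := by linarith
    have hl : Real.log t ≠ 0 := (Real.log_pos ht).ne'
    have h1 : HasDerivAt (fun t ↦ t * Real.log t) (1 * Real.log t + t * t⁻¹) t :=
      (hasDerivAt_id t).mul (Real.hasDerivAt_log ht0)
    have h2 := h1.inv (mul_ne_zero ht0 hl)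
    have e : g t = -(1 * Real.log t + t * t⁻¹) / (t * Real.log t) ^ 2 := by
      rw [hg]; field_simp
    rw [e]
    exact h2
  have hf_diff : ∀ t ∈ Set.Icc y x, DifferentiableAt ℝ f t := fun t ht ↦
    (hderiv t (by linarith [ht.1])).differentiableAt
  have hderiv_eq : Set.EqOn g (deriv f) (Set.Icc y x) := fun t ht ↦
    ((hderiv t (by linarith [ht.1])).deriv).symm
  have hmem : ∀ t ∈ Set.Icc y x, t ∈ ({0}ᶜ : Set ℝ) := fun t ht ↦
    Set.mem_compl_singleton_iff.mpr (show (0 : ℝ) < t by linarith [ht.1]).ne'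
  have hlogne : ∀ t ∈ Set.Icc y x, Real.log t ≠ 0 := fun t ht ↦
    (Real.log_pos (by linarith [ht.1])).ne'
  have hgcont : ContinuousOn g (Set.Icc y x) := by
    refine ContinuousOn.neg (ContinuousOn.div ?_ ?_ fun t ht ↦ ?_)
    · exact ((Real.continuousOn_log.mono hmem).add continuousOn_const)
    · exact ((continuousOn_id.mul (Real.continuousOn_log.mono hmem)).pow 2)
    · exact pow_ne_zero _ (mul_ne_zero (by linarith [ht.1]) (hlogne t ht))
  have hf_int : IntegrableOn (deriv f) (Set.Icc y x) :=
    hgcont.integrableOn_Icc.congr_fun hderiv_eq measurableSet_Icc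
  have habel := sum_mul_eq_sub_sub_integral_mul c (by linarith : (0 : ℝ) ≤ y) hyx hf_diff hf_int
  have hS : ∀ t : ℝ, ∑ k ∈ Icc 0 ⌊t⌋₊, c k = θ t := fun t ↦ by
    rw [hc, PrimeSquareTail.sum_Icc_ite_prime_log]
  have hfc : ∀ k : ℕ, f k * c k = if k.Prime then (1 : ℝ) / k else 0 := by
    intro k
    simp only [hf, hc]
    split_ifs with hk
    · have hk1 : (1 : ℝ) < k := by exact_mod_cast hk.one_lt
      have : Real.log k ≠ 0 := (Real.log_pos hk1).ne'
      field_simp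
    · simp
  have hlhs : ∑ k ∈ Finset.Ioc ⌊y⌋₊ ⌊x⌋₊, f k * c k
      = ∑ p ∈ (Finset.Ioc ⌊y⌋₊ ⌊x⌋₊).filter Nat.Prime, (1 : ℝ) / p := by
    rw [Finset.sum_filter]
    exact Finset.sum_congr rfl fun k _ ↦ hfc k
  have hint : ∫ t in Set.Ioc y x, deriv f t * ∑ k ∈ Icc 0 ⌊t⌋₊, c k =
      -∫ t in Set.Ioc y x, θ t * ((Real.log t + 1) / (t * Real.log t) ^ 2) := by
    rw [← MeasureTheory.integral_neg]
    refine setIntegral_congr_fun measurableSet_Ioc fun t ht ↦ ?_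
    rw [← hderiv_eq (Set.Ioc_subset_Icc_self ht), hS, hg]
    ring
  rw [hlhs, hS, hS, hint, hf] at habel
  rw [habel]
  simp only [mul_inv_rev]
  field_simp
  ring

/-! ## Auxiliary integrals -/

/-- `∫_y^x (log t + 1)/(t log² t) dt = log log x − log log y + 1/log y − 1/log x` (`1 < y ≤ x`).
[folklore] -/
theorem integral_log_add_one_div {y x : ℝ} (hy : 1 < y) (hyx : y ≤ x) :
    ∫ t in y..x, (Real.log t + 1) / (t * Real.log t ^ 2)
      = (Real.log (Real.log x) - Real.log (Real.log y)) + (1 / Real.log y - 1 / Real.log x) := by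
  set F : ℝ → ℝ := fun t ↦ Real.log (Real.log t) - (Real.log t)⁻¹ with hF
  have hderiv : ∀ t ∈ Set.uIcc y x, HasDerivAt F ((Real.log t + 1) / (t * Real.log t ^ 2)) t := by
    intro t ht
    rw [Set.uIcc_of_le hyx] at ht
    have ht1 : 1 < t := by linarith [ht.1]
    have ht0 : t ≠ 0 := by linarith
    have hl : Real.log t ≠ 0 := (Real.log_pos ht1).ne'
    have h1 : HasDerivAt (fun t ↦ Real.log (Real.log t)) (t⁻¹ / Real.log t) t :=
      (Real.hasDerivAt_log ht0).log hl
    have h2 : HasDerivAt (fun t ↦ (Real.log t)⁻¹) (-(t⁻¹) / Real.log t ^ 2) t :=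
      (Real.hasDerivAt_log ht0).inv hl
    have h3 := h1.sub h2
    refine h3.congr_deriv ?_
    field_simp
    ring
  have hcont : ContinuousOn (fun t ↦ (Real.log t + 1) / (t * Real.log t ^ 2)) (Set.uIcc y x) := by
    rw [Set.uIcc_of_le hyx]
    have hmem : ∀ t ∈ Set.Icc y x, t ∈ ({0}ᶜ : Set ℝ) := fun t ht ↦
      Set.mem_compl_singleton_iff.mpr (show (0 : ℝ) < t by linarith [ht.1]).ne'
    refine ContinuousOn.div ((Real.continuousOn_log.mono hmem).add continuousOn_const)
      (continuousOn_id.mul ((Real.continuousOn_log.mono hmem).pow 2)) fun t ht ↦ ?_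
    have : Real.log t ≠ 0 := (Real.log_pos (by linarith [ht.1])).ne'
    exact mul_ne_zero (by linarith [ht.1]) (pow_ne_zero _ this)
  rw [integral_eq_sub_of_hasDerivAt hderiv (hcont.intervalIntegrable)]
  simp only [hF]
  ring

/-- `∫_y^x dt/(t√t) ≤ 2/√y` (`0 < y ≤ x`). [folklore] -/
theorem integral_inv_mul_sqrt_le {y x : ℝ} (hy : 0 < y) (hyx : y ≤ x) :
    ∫ t in y..x, 1 / (t * Real.sqrt t) ≤ 2 / Real.sqrt y := by
  set F : ℝ → ℝ := fun t ↦ -2 * (Real.sqrt t)⁻¹ with hF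
  have hderiv : ∀ t ∈ Set.uIcc y x, HasDerivAt F (1 / (t * Real.sqrt t)) t := by
    intro t ht
    rw [Set.uIcc_of_le hyx] at ht
    have ht0 : 0 < t := by linarith [ht.1]
    have hs : Real.sqrt t ≠ 0 := (Real.sqrt_pos.2 ht0).ne'
    have h1 := ((Real.hasDerivAt_sqrt ht0.ne').inv hs).const_mul (-2)
    refine h1.congr_deriv ?_
    have : Real.sqrt t ^ 2 = t := Real.sq_sqrt ht0.le
    field_simp
    nlinarith [this]
  have hcont : ContinuousOn (fun t ↦ 1 / (t * Real.sqrt t)) (Set.uIcc y x) := by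
    rw [Set.uIcc_of_le hyx]
    refine ContinuousOn.div continuousOn_const (continuousOn_id.mul (Real.continuous_sqrt.continuousOn))
      fun t ht ↦ ?_
    have ht0 : 0 < t := by linarith [ht.1]
    exact mul_ne_zero ht0.ne' (Real.sqrt_pos.2 ht0).ne'
  rw [integral_eq_sub_of_hasDerivAt hderiv (hcont.intervalIntegrable)]
  simp only [hF]
  have hx0 : 0 < Real.sqrt x := Real.sqrt_pos.2 (by linarith)
  have : 0 ≤ 2 * (Real.sqrt x)⁻¹ := by positivity
  rw [div_eq_mul_inv]
  linarith


/-- The final linear step of the lower bound (isolated for speed). [folklore] -/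
theorem lower_final_step {A B J I₂ LL Lx Ly sy a1 a2 a3 : ℝ}
    (hA : 0.9392 / Lx - a1 - a2 ≤ A) (hB : B ≤ 1.0722 / Ly + a3)
    (hJ : 0.9392 * (LL + (1 / Ly - 1 / Lx)) - 3.2 * I₂ ≤ J) (hI2 : I₂ ≤ 2 / sy)
    (hsmall : a1 + a2 + a3 + 3.2 * (2 / sy) ≤ 12 / sy) :
    0.9392 * LL - (1.0722 / Ly - 0.9392 / Ly) - 12 / sy ≤ A - B + J := by
  simp only [div_eq_mul_inv] at hA hB hJ hI2 hsmall ⊢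
  linarith

/-! ## The bounds -/

/-- **Lower bound.** For `e¹⁰ ≤ y ≤ x`:
`∑_{y<p≤x} 1/p ≥ 0.9392 · (log log x − log log y) − 0.133/log y − 12/√y`.
[cite: Ford2002, §2 (substitute for Rosser–Schoenfeld (2.3))] -/
theorem sum_inv_primes_window_ge {y x : ℝ} (hy : Real.exp 10 ≤ y) (hyx : y ≤ x) :
    0.9392 * (Real.log (Real.log x) - Real.log (Real.log y)) - 0.133 / Real.log y - 12 / Real.sqrt y
      ≤ ∑ p ∈ (Finset.Ioc ⌊y⌋₊ ⌊x⌋₊).filter Nat.Prime, (1 : ℝ) / p := by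
  have h10 : (10 : ℝ) + 1 ≤ Real.exp 10 := Real.add_one_le_exp 10
  have hy1 : 1 < y := by linarith
  have hy2 : 2 ≤ y := by linarith
  have hx1 : 1 < x := by linarith
  have hly : 10 ≤ Real.log y := by
    rw [Real.le_log_iff_exp_le (by linarith)]; exact hy
  have hlx : 10 ≤ Real.log x := hly.trans (Real.log_le_log (by linarith) hyx)
  have hly0 : 0 < Real.log y := by linarith
  have hlx0 : 0 < Real.log x := by linarith
  have hsy : 0 < Real.sqrt y := Real.sqrt_pos.2 (by linarith)
  have hsx : 0 < Real.sqrt x := Real.sqrt_pos.2 (by linarith)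
  have hsyx : Real.sqrt y ≤ Real.sqrt x := Real.sqrt_le_sqrt hyx
  rw [sum_inv_primes_window_eq hy2 hyx]
  have hx0 : 0 < x := by linarith
  have hy0 : 0 < y := by linarith
  have hsqx : Real.sqrt x ^ 2 = x := Real.sq_sqrt hx0.le
  have hsqy : Real.sqrt y ^ 2 = y := Real.sq_sqrt hy0.le
  -- boundary terms
  obtain ⟨hθx, -⟩ := theta_bounds_sylvester (x := x) hx1.le
  obtain ⟨-, hθy⟩ := theta_bounds_sylvester (x := y) hy1.le
  have hA : 0.9392 / Real.log x - 9 / (Real.sqrt x * Real.log x) - 2 / Real.sqrt x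
      ≤ θ x / (x * Real.log x) := by
    rw [le_div_iff₀ (by positivity)]
    have e : (0.9392 / Real.log x - 9 / (Real.sqrt x * Real.log x) - 2 / Real.sqrt x) * (x * Real.log x)
        = 0.9392 * x - 9 * Real.sqrt x - 2 * Real.sqrt x * Real.log x := by
      field_simp
      nlinarith [hsqx]
    rw [e]; exact hθx
  have hB : θ y / (y * Real.log y) ≤ 1.0722 / Real.log y + 7 / (Real.sqrt y * Real.log y) := by
    rw [div_le_iff₀ (by positivity)]
    have e : (1.0722 / Real.log y + 7 / (Real.sqrt y * Real.log y)) * (y * Real.log y)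
        = 1.0722 * y + 7 * Real.sqrt y := by
      field_simp
      nlinarith [hsqy]
    rw [e]; exact hθy
  -- the integral term
  set w : ℝ → ℝ := fun t ↦ (Real.log t + 1) / (t * Real.log t) ^ 2 with hw
  set g₁ : ℝ → ℝ := fun t ↦ (Real.log t + 1) / (t * Real.log t ^ 2) with hg₁
  set g₂ : ℝ → ℝ := fun t ↦ 1 / (t * Real.sqrt t) with hg₂
  have hmem : ∀ t ∈ Set.Icc y x, t ∈ ({0}ᶜ : Set ℝ) := fun t ht ↦
    Set.mem_compl_singleton_iff.mpr (show (0 : ℝ) < t by linarith [ht.1]).ne'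
  have hwcont : ContinuousOn w (Set.Icc y x) := by
    refine ContinuousOn.div ((Real.continuousOn_log.mono hmem).add continuousOn_const)
      ((continuousOn_id.mul (Real.continuousOn_log.mono hmem)).pow 2) fun t ht ↦ ?_
    have : Real.log t ≠ 0 := (Real.log_pos (by linarith [ht.1])).ne'
    exact pow_ne_zero _ (mul_ne_zero (by linarith [ht.1]) this)
  have hg₁cont : ContinuousOn g₁ (Set.Icc y x) := by
    refine ContinuousOn.div ((Real.continuousOn_log.mono hmem).add continuousOn_const)
      (continuousOn_id.mul ((Real.continuousOn_log.mono hmem).pow 2)) fun t ht ↦ ?_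
    have : Real.log t ≠ 0 := (Real.log_pos (by linarith [ht.1])).ne'
    exact mul_ne_zero (by linarith [ht.1]) (pow_ne_zero _ this)
  have hg₂cont : ContinuousOn g₂ (Set.Icc y x) := by
    refine ContinuousOn.div continuousOn_const (continuousOn_id.mul Real.continuous_sqrt.continuousOn)
      fun t ht ↦ ?_
    have ht0 : 0 < t := by linarith [ht.1]
    exact mul_ne_zero ht0.ne' (Real.sqrt_pos.2 ht0).ne'
  -- pointwise lower bound of the integrand on `(y, x]`
  have hpt : ∀ t ∈ Set.Ioc y x, 0.9392 * g₁ t - 3.2 * g₂ t ≤ θ t * w t := by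
    intro t ht
    have ht1 : 1 < t := by linarith [ht.1]
    have ht0 : 0 < t := by linarith
    have hlt : 10 ≤ Real.log t := hly.trans (Real.log_le_log hy0 ht.1.le)
    have hlt0 : 0 < Real.log t := by linarith
    have hst : 0 < Real.sqrt t := Real.sqrt_pos.2 ht0
    have hsqt : Real.sqrt t ^ 2 = t := Real.sq_sqrt ht0.le
    obtain ⟨hθt, -⟩ := theta_bounds_sylvester (x := t) ht1.le
    have hw0 : 0 ≤ w t := by rw [hw]; positivity
    -- `θ t · w t ≥ (a t − 9√t − 2√t log t) w t`
    have h1 : (0.9392 * t - 9 * Real.sqrt t - 2 * Real.sqrt t * Real.log t) * w t ≤ θ t * w t :=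
      mul_le_mul_of_nonneg_right hθt hw0
    refine le_trans ?_ h1
    -- `a t w = a g₁`, and `(9 + 2 log t)√t w ≤ 3.2 g₂`
    have e1 : t * w t = g₁ t := by
      simp only [hw, hg₁]; field_simp
    have e2 : (9 * Real.sqrt t + 2 * Real.sqrt t * Real.log t) * w t
        = ((9 + 2 * Real.log t) * (Real.log t + 1) / Real.log t ^ 2) * g₂ t := by
      simp only [hw, hg₂]; field_simp; nlinarith [hsqt]
    have e3 : (9 + 2 * Real.log t) * (Real.log t + 1) / Real.log t ^ 2 ≤ 3.2 := by
      rw [div_le_iff₀ (by positivity)]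
      have hL2 : 10 * Real.log t ≤ Real.log t * Real.log t :=
        mul_le_mul_of_nonneg_right hlt hlt0.le
      nlinarith [hL2]
    have hg₂0 : 0 ≤ g₂ t := by rw [hg₂]; positivity
    have : (0.9392 * t - 9 * Real.sqrt t - 2 * Real.sqrt t * Real.log t) * w t
        = 0.9392 * (t * w t) - (9 * Real.sqrt t + 2 * Real.sqrt t * Real.log t) * w t := by ring
    rw [this, e1, e2]
    have h4 := mul_le_mul_of_nonneg_right e3 hg₂0
    linarith
  -- integrability of `θ · w` on `(y, x]` (θ bounded by θ x there)
  have hθw_int : IntegrableOn (fun t ↦ θ t * w t) (Set.Ioc y x) := by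
    have hθ' : IntegrableOn (fun t ↦ θ (min t x) * w t) (Set.Ioc y x) := by
      have hwint : IntegrableOn w (Set.Ioc y x) := (hwcont.integrableOn_Icc).mono_set Set.Ioc_subset_Icc_self
      refine Integrable.bdd_mul (c := θ x) hwint ?_ ?_
      · exact ((Chebyshev.theta_mono.measurable).comp (measurable_id.min measurable_const)).aestronglyMeasurable
      · refine ae_of_all _ fun t ↦ ?_
        rw [Real.norm_eq_abs, abs_of_nonneg (Chebyshev.theta_nonneg _)]
        exact Chebyshev.theta_mono (min_le_right _ _)
    refine hθ'.congr_fun (fun t ht ↦ ?_) measurableSet_Ioc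
    simp [min_eq_left ht.2]
  have hJ : ∫ t in Set.Ioc y x, (0.9392 * g₁ t - 3.2 * g₂ t) ≤ ∫ t in Set.Ioc y x, θ t * w t := by
    refine setIntegral_mono_on ?_ hθw_int measurableSet_Ioc hpt
    exact (((hg₁cont.integrableOn_Icc).mono_set Set.Ioc_subset_Icc_self).const_mul _).sub
      (((hg₂cont.integrableOn_Icc).mono_set Set.Ioc_subset_Icc_self).const_mul _)
  have hJeval : ∫ t in Set.Ioc y x, (0.9392 * g₁ t - 3.2 * g₂ t)
      = 0.9392 * ((Real.log (Real.log x) - Real.log (Real.log y)) + (1 / Real.log y - 1 / Real.log x))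
        - 3.2 * ∫ t in y..x, g₂ t := by
    rw [← intervalIntegral.integral_of_le hyx, intervalIntegral.integral_sub, intervalIntegral.integral_const_mul,
      intervalIntegral.integral_const_mul, hg₁, integral_log_add_one_div hy1 hyx]
    · exact ((hg₁cont.mono (by rw [Set.uIcc_of_le hyx])).intervalIntegrable).const_mul _
    · exact ((hg₂cont.mono (by rw [Set.uIcc_of_le hyx])).intervalIntegrable).const_mul _
  rw [hJeval] at hJ
  simp only [hg₂, hw] at hJ
  have hI2 := integral_inv_mul_sqrt_le hy0 hyx
  -- collect the small terms
  have hsmall : 9 / (Real.sqrt x * Real.log x) + 2 / Real.sqrt x + 7 / (Real.sqrt y * Real.log y)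
      + 3.2 * (2 / Real.sqrt y) ≤ 12 / Real.sqrt y := by
    have t1 : 9 / (Real.sqrt x * Real.log x) ≤ 0.9 / Real.sqrt y := by
      rw [div_le_div_iff₀ (by positivity) hsy]
      have h := mul_le_mul_of_nonneg_left hlx hsx.le
      linarith only [h, hsyx]
    have t2 : 2 / Real.sqrt x ≤ 2 / Real.sqrt y := div_le_div_of_nonneg_left (by norm_num) hsy hsyx
    have t3 : 7 / (Real.sqrt y * Real.log y) ≤ 0.7 / Real.sqrt y := by
      rw [div_le_div_iff₀ (by positivity) hsy]
      have h := mul_le_mul_of_nonneg_left hly hsy.le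
      linarith only [h]
    have h7 : 0.9 / Real.sqrt y + 2 / Real.sqrt y + 0.7 / Real.sqrt y + 3.2 * (2 / Real.sqrt y)
        = 10 / Real.sqrt y := by ring
    have h12 : 10 / Real.sqrt y ≤ 12 / Real.sqrt y := div_le_div_of_nonneg_right (by norm_num) hsy.le
    linarith only [t1, t2, t3, h7, h12]
  have e : (0.133 : ℝ) / Real.log y = 1.0722 / Real.log y - 0.9392 / Real.log y := by ring
  rw [e]
  exact lower_final_step hA hB hJ hI2 hsmall


/-- The final linear step of the upper bound (isolated for speed). [folklore] -/
theorem upper_final_step {A B J I₂ LL Lx Ly sy a1 a2 a3 : ℝ}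
    (hA : A ≤ 1.0722 / Lx + a1) (hB : 0.9392 / Ly - a2 - a3 ≤ B)
    (hJ : J ≤ 1.0722 * (LL + (1 / Ly - 1 / Lx)) + 0.77 * I₂) (hI2 : I₂ ≤ 2 / sy)
    (hsmall : a1 + a2 + a3 + 0.77 * (2 / sy) ≤ 12 / sy) :
    A - B + J ≤ 1.0722 * LL + (1.0722 / Ly - 0.9392 / Ly) + 12 / sy := by
  simp only [div_eq_mul_inv] at hA hB hJ hI2 hsmall ⊢
  linarith

/-- **Upper bound.** For `e¹⁰ ≤ y ≤ x`:
`∑_{y<p≤x} 1/p ≤ 1.0722 · (log log x − log log y) + 0.133/log y + 12/√y`.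
[cite: Ford2002, §2 (substitute for Rosser–Schoenfeld (2.3))] -/
theorem sum_inv_primes_window_le {y x : ℝ} (hy : Real.exp 10 ≤ y) (hyx : y ≤ x) :
    ∑ p ∈ (Finset.Ioc ⌊y⌋₊ ⌊x⌋₊).filter Nat.Prime, (1 : ℝ) / p
      ≤ 1.0722 * (Real.log (Real.log x) - Real.log (Real.log y)) + 0.133 / Real.log y
        + 12 / Real.sqrt y := by
  have h10 : (10 : ℝ) + 1 ≤ Real.exp 10 := Real.add_one_le_exp 10
  have hy1 : 1 < y := by linarith
  have hy2 : 2 ≤ y := by linarith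
  have hx1 : 1 < x := by linarith
  have hly : 10 ≤ Real.log y := by
    rw [Real.le_log_iff_exp_le (by linarith)]; exact hy
  have hlx : 10 ≤ Real.log x := hly.trans (Real.log_le_log (by linarith) hyx)
  have hly0 : 0 < Real.log y := by linarith
  have hlx0 : 0 < Real.log x := by linarith
  have hsy : 0 < Real.sqrt y := Real.sqrt_pos.2 (by linarith)
  have hsx : 0 < Real.sqrt x := Real.sqrt_pos.2 (by linarith)
  have hsyx : Real.sqrt y ≤ Real.sqrt x := Real.sqrt_le_sqrt hyx
  rw [sum_inv_primes_window_eq hy2 hyx]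
  have hx0 : 0 < x := by linarith
  have hy0 : 0 < y := by linarith
  have hsqx : Real.sqrt x ^ 2 = x := Real.sq_sqrt hx0.le
  have hsqy : Real.sqrt y ^ 2 = y := Real.sq_sqrt hy0.le
  -- boundary terms
  obtain ⟨-, hθx⟩ := theta_bounds_sylvester (x := x) hx1.le
  obtain ⟨hθy, -⟩ := theta_bounds_sylvester (x := y) hy1.le
  have hA : θ x / (x * Real.log x) ≤ 1.0722 / Real.log x + 7 / (Real.sqrt x * Real.log x) := by
    rw [div_le_iff₀ (by positivity)]
    have e : (1.0722 / Real.log x + 7 / (Real.sqrt x * Real.log x)) * (x * Real.log x)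
        = 1.0722 * x + 7 * Real.sqrt x := by
      field_simp
      nlinarith [hsqx]
    rw [e]; exact hθx
  have hB : 0.9392 / Real.log y - 9 / (Real.sqrt y * Real.log y) - 2 / Real.sqrt y
      ≤ θ y / (y * Real.log y) := by
    rw [le_div_iff₀ (by positivity)]
    have e : (0.9392 / Real.log y - 9 / (Real.sqrt y * Real.log y) - 2 / Real.sqrt y) * (y * Real.log y)
        = 0.9392 * y - 9 * Real.sqrt y - 2 * Real.sqrt y * Real.log y := by
      field_simp
      nlinarith [hsqy]
    rw [e]; exact hθy
  -- the integral term
  set w : ℝ → ℝ := fun t ↦ (Real.log t + 1) / (t * Real.log t) ^ 2 with hw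
  set g₁ : ℝ → ℝ := fun t ↦ (Real.log t + 1) / (t * Real.log t ^ 2) with hg₁
  set g₂ : ℝ → ℝ := fun t ↦ 1 / (t * Real.sqrt t) with hg₂
  have hmem : ∀ t ∈ Set.Icc y x, t ∈ ({0}ᶜ : Set ℝ) := fun t ht ↦
    Set.mem_compl_singleton_iff.mpr (show (0 : ℝ) < t by linarith [ht.1]).ne'
  have hwcont : ContinuousOn w (Set.Icc y x) := by
    refine ContinuousOn.div ((Real.continuousOn_log.mono hmem).add continuousOn_const)
      ((continuousOn_id.mul (Real.continuousOn_log.mono hmem)).pow 2) fun t ht ↦ ?_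
    have : Real.log t ≠ 0 := (Real.log_pos (by linarith [ht.1])).ne'
    exact pow_ne_zero _ (mul_ne_zero (by linarith [ht.1]) this)
  have hg₁cont : ContinuousOn g₁ (Set.Icc y x) := by
    refine ContinuousOn.div ((Real.continuousOn_log.mono hmem).add continuousOn_const)
      (continuousOn_id.mul ((Real.continuousOn_log.mono hmem).pow 2)) fun t ht ↦ ?_
    have : Real.log t ≠ 0 := (Real.log_pos (by linarith [ht.1])).ne'
    exact mul_ne_zero (by linarith [ht.1]) (pow_ne_zero _ this)
  have hg₂cont : ContinuousOn g₂ (Set.Icc y x) := by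
    refine ContinuousOn.div continuousOn_const (continuousOn_id.mul Real.continuous_sqrt.continuousOn)
      fun t ht ↦ ?_
    have ht0 : 0 < t := by linarith [ht.1]
    exact mul_ne_zero ht0.ne' (Real.sqrt_pos.2 ht0).ne'
  -- pointwise upper bound of the integrand on `(y, x]`
  have hpt : ∀ t ∈ Set.Ioc y x, θ t * w t ≤ 1.0722 * g₁ t + 0.77 * g₂ t := by
    intro t ht
    have ht1 : 1 < t := by linarith [ht.1]
    have ht0 : 0 < t := by linarith
    have hlt : 10 ≤ Real.log t := hly.trans (Real.log_le_log hy0 ht.1.le)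
    have hlt0 : 0 < Real.log t := by linarith
    have hst : 0 < Real.sqrt t := Real.sqrt_pos.2 ht0
    have hsqt : Real.sqrt t ^ 2 = t := Real.sq_sqrt ht0.le
    obtain ⟨-, hθt⟩ := theta_bounds_sylvester (x := t) ht1.le
    have hw0 : 0 ≤ w t := by rw [hw]; positivity
    have h1 : θ t * w t ≤ (1.0722 * t + 7 * Real.sqrt t) * w t :=
      mul_le_mul_of_nonneg_right hθt hw0
    refine h1.trans ?_
    have e1 : t * w t = g₁ t := by
      simp only [hw, hg₁]; field_simp
    have e2 : Real.sqrt t * w t = ((Real.log t + 1) / Real.log t ^ 2) * g₂ t := by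
      simp only [hw, hg₂]; field_simp; nlinarith [hsqt]
    have e3 : (Real.log t + 1) / Real.log t ^ 2 ≤ 0.11 := by
      rw [div_le_iff₀ (by positivity)]
      have hL2 : 10 * Real.log t ≤ Real.log t * Real.log t :=
        mul_le_mul_of_nonneg_right hlt hlt0.le
      nlinarith [hL2]
    have hg₂0 : 0 ≤ g₂ t := by rw [hg₂]; positivity
    have : (1.0722 * t + 7 * Real.sqrt t) * w t
        = 1.0722 * (t * w t) + 7 * (Real.sqrt t * w t) := by ring
    rw [this, e1, e2]
    have h4 := mul_le_mul_of_nonneg_right e3 hg₂0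
    linarith [h4]
  -- integrability of `θ · w` on `(y, x]` (θ bounded by θ x there)
  have hθw_int : IntegrableOn (fun t ↦ θ t * w t) (Set.Ioc y x) := by
    have hθ' : IntegrableOn (fun t ↦ θ (min t x) * w t) (Set.Ioc y x) := by
      have hwint : IntegrableOn w (Set.Ioc y x) := (hwcont.integrableOn_Icc).mono_set Set.Ioc_subset_Icc_self
      refine Integrable.bdd_mul (c := θ x) hwint ?_ ?_
      · exact ((Chebyshev.theta_mono.measurable).comp (measurable_id.min measurable_const)).aestronglyMeasurable
      · refine ae_of_all _ fun t ↦ ?_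
        rw [Real.norm_eq_abs, abs_of_nonneg (Chebyshev.theta_nonneg _)]
        exact Chebyshev.theta_mono (min_le_right _ _)
    refine hθ'.congr_fun (fun t ht ↦ ?_) measurableSet_Ioc
    simp [min_eq_left ht.2]
  have hJ : ∫ t in Set.Ioc y x, θ t * w t ≤ ∫ t in Set.Ioc y x, (1.0722 * g₁ t + 0.77 * g₂ t) := by
    refine setIntegral_mono_on hθw_int ?_ measurableSet_Ioc hpt
    exact (((hg₁cont.integrableOn_Icc).mono_set Set.Ioc_subset_Icc_self).const_mul _).add
      (((hg₂cont.integrableOn_Icc).mono_set Set.Ioc_subset_Icc_self).const_mul _)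
  have hJeval : ∫ t in Set.Ioc y x, (1.0722 * g₁ t + 0.77 * g₂ t)
      = 1.0722 * ((Real.log (Real.log x) - Real.log (Real.log y)) + (1 / Real.log y - 1 / Real.log x))
        + 0.77 * ∫ t in y..x, g₂ t := by
    rw [← intervalIntegral.integral_of_le hyx, intervalIntegral.integral_add, intervalIntegral.integral_const_mul,
      intervalIntegral.integral_const_mul, hg₁, integral_log_add_one_div hy1 hyx]
    · exact ((hg₁cont.mono (by rw [Set.uIcc_of_le hyx])).intervalIntegrable).const_mul _
    · exact ((hg₂cont.mono (by rw [Set.uIcc_of_le hyx])).intervalIntegrable).const_mul _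
  rw [hJeval] at hJ
  simp only [hg₂, hw] at hJ
  have hI2 := integral_inv_mul_sqrt_le hy0 hyx
  -- collect the small terms
  have hsmall : 7 / (Real.sqrt x * Real.log x) + 9 / (Real.sqrt y * Real.log y) + 2 / Real.sqrt y
      + 0.77 * (2 / Real.sqrt y) ≤ 12 / Real.sqrt y := by
    have t1 : 7 / (Real.sqrt x * Real.log x) ≤ 0.7 / Real.sqrt y := by
      rw [div_le_div_iff₀ (by positivity) hsy]
      have h := mul_le_mul_of_nonneg_left hlx hsx.le
      linarith only [h, hsyx]
    have t3 : 9 / (Real.sqrt y * Real.log y) ≤ 0.9 / Real.sqrt y := by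
      rw [div_le_div_iff₀ (by positivity) hsy]
      have h := mul_le_mul_of_nonneg_left hly hsy.le
      linarith only [h]
    have h7 : 0.7 / Real.sqrt y + 0.9 / Real.sqrt y + 2 / Real.sqrt y + 0.77 * (2 / Real.sqrt y)
        = 5.14 / Real.sqrt y := by ring
    have h12 : 5.14 / Real.sqrt y ≤ 12 / Real.sqrt y := div_le_div_of_nonneg_right (by norm_num) hsy.le
    linarith only [t1, t3, h7, h12]
  have e : (0.133 : ℝ) / Real.log y = 1.0722 / Real.log y - 0.9392 / Real.log y := by ring
  rw [e]
  exact upper_final_step hA hB hJ hI2 hsmall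

end MertensChebyshev
end Literature.NumberTheory.LFunctions
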